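import Mathlib.LinearAlgebra.Charpoly.BaseChange
import Mathlib.RingTheory.AdjoinRoot
import Mathlib.RingTheory.Polynomial.Dickson
import Literature.LinearAlgebra.FreeModule.DetQuotientPadicCard
import Literature.NumberTheory.EllipticCurves.FrobeniusTraceBaseChange
import HarnessLib

/-!
# The determinant and the index of the Euler operator `φ² − aφ + q` of an endomorphism with
# characteristic polynomial `X^f − 1`
# (cell `bsd-addord`, seat w2-acc3 gen 7; route W2 `KimAtThreeKolyvagin`; `--supports 19679`, helper)

HONEST FRAMING.  Route W2 (`route-BirchSwinnertonDyer-KimAtThreeKolyvagin`), items 19679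
`DeepLowerAtThreeOffKatoStratum` / 19599 and the support item 20397 `FineKatoTauAnomalousThree`
(the good-ANOMALOUS `t = 0` rows).  Their one non-kernel algebraic input (acc3 gen 6 HANDOFF; w2-c4
gen 9 memo §2 "LATTICE LEMMA") is the E-side index identity
`log_ω E(K) = {y : (φ² − a_pφ + p) y ∈ p𝒪_K}` (up to `#E(K)[p^∞]`) for an unramified `K/ℚ_p` with
Frobenius `φ`.  THIS FILE is its PURE-ALGEBRA half: the size of the Euler lattice.  TOOL theorems only
(no definition, no named fact, no `sorry`); closes nothing by itself; nothing booked; BSD is not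
proved by any of this.

## What is proved

For a finite free module `M` over a commutative ring `R`, an endomorphism `φ` whose characteristic
polynomial is `X^f − 1` (e.g. a generator of a cyclic group of order `f = rank M` in its regular
representation — the Frobenius of an unramified `K/ℚ_p` of degree `f` acting on `𝒪_K`), and scalars
`a, q ∈ R`, the **Euler operator** `E(φ) = φ² − a φ + q = aeval φ (X² − aX + q)` satisfies

* `det_aeval_eulerPoly_of_charpoly_eq`: **`det E(φ) = q^f + 1 − D_f(a; q)`**, `D_f = Polynomial.dickson 1 q f`
  (`D_f(λ + μ; λμ) = λ^f + μ^f`, the tree's `WeierstrassCurve.pow_add_pow_eq_eval_dickson`): if `X² − aX + q = (X − λ)(X − μ)`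
  then `det E(φ) = ∏_{ζ^f = 1} (ζ − λ)(ζ − μ) = (λ^f − 1)(μ^f − 1) = (λμ)^f − (λ^f + μ^f) + 1` — the
  resultant of `X^f − 1` and `X² − aX + q`;
* `natCard_quotient_range_aeval_eulerPoly_of_charpoly_eq` (`R = ℤ_p`): **`#(M ⧸ E(φ) M) =
  p ^ v_p(q^f + 1 − D_f(a; q))`** whenever that number is non-zero (tree
  `Literature.LinearAlgebra.FreeModule.natCard_quotient_range_eq_pow_valuation_det`, Stacks 02QG);
* `charpoly_eq_X_pow_sub_one_of_linearIndependent`: `χ_φ = X^f − 1` as soon as `φ^f = 1`,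
  `f = rank M > 0` and `1, φ, …, φ^{f−1}` are linearly independent (Cayley–Hamilton);
* plumbing: `aeval_eulerPoly_eq/_apply`, `adjoinRoot_of_injective_of_monic`, `det_sub_algebraMap_eq`
  (`det(φ − c) = (−1)^{rank} χ_φ(c)`), `injective_of_det_ne_zero`.

For the elliptic curve with trace of Frobenius `a = a_p` at a good prime `p` and `q = p`: the operator
`φ² − a_pφ + p = p · E_p(φ)` (`E_p(X) = 1 − a_pX/p + X²/p`) on `𝒪_K` has index the `p`-part of
`p^f + 1 − (α^f + β^f) = #Ẽ(𝔽_{p^f})` (Silverman V.2.3.1, proof) — the "digit loss" on anomalous rows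
(`a_p ≡ 1 (mod p)`); the identification with `#Ẽ(k)[p^∞]` and `log_ω E(K)` is the arithmetic half
(sequel files).

## Proof of the determinant

Adjoin a root `λ` of `g = X² − aX + q` (`A = AdjoinRoot g`; `R → A` is injective as `g` is monic of
degree `2`), put `μ = a − λ`; over `A`, `g = (X − λ)(X − μ)`, the base change of `φ` still has
characteristic polynomial `X^f − 1` (Mathlib `LinearMap.charpoly_baseChange`), and
`det(φ_A − c) = (−1)^f χ(c) = (−1)^f (c^f − 1)` (`LinearMap.eval_charpoly`, `LinearMap.det_smul`);
multiply, use `λ^f + μ^f = D_f(a; q)` and descend with `LinearMap.det_baseChange`.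

References: R. Lidl, G. L. Mullen, G. Turnwald, *Dickson polynomials* (1993), (1.1), Lemma 2.1
(`D_n(x + y, xy) = x^n + y^n`; Mathlib `Polynomial.dickson`); The Stacks Project, Tag 02QG
[StacksProject]; J. H. Silverman, *AEC* 2nd ed. (2009), Thm. V.2.3.1 and its proof [SilvermanAEC2009].
-/
noncomputable section

open Polynomial Module

-- the cell's Theorems namespace repeats the summit name by design (D-0017)
set_option linter.dupNamespace false

namespace Summit.BirchSwinnertonDyer.BirchSwinnertonDyer.Theorems.KimAtThreeEulerOperatorDeterminant

open Literature.LinearAlgebra.FreeModule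

/-! ## The Euler operator `aeval φ (X² − aX + q)` -/

section CommRing

variable {R : Type*} [CommRing R] {M : Type*} [AddCommGroup M] [Module R M]

/-- Unfolding: `aeval φ (X² − aX + q) = φ ∘ φ − a • φ + q • 1`. [folklore] -/
theorem aeval_eulerPoly_eq (φ : Module.End R M) (a q : R) :
    aeval φ (X ^ 2 - C a * X + C q) = φ * φ - a • φ + algebraMap R (Module.End R M) q := by
  simp only [map_add, map_sub, map_mul, aeval_C, aeval_X, pow_two, Algebra.smul_def]

/-- Pointwise form: `(aeval φ (X² − aX + q)) m = φ (φ m) − a • φ m + q • m`. [folklore] -/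
theorem aeval_eulerPoly_apply (φ : Module.End R M) (a q : R) (m : M) :
    aeval φ (X ^ 2 - C a * X + C q) m = φ (φ m) - a • φ m + q • m := by
  rw [aeval_eulerPoly_eq]
  simp [Module.algebraMap_end_apply]

/-- `R → AdjoinRoot g` is injective for a monic `g` of positive degree (a non-zero constant is not
a multiple of `g`). [folklore] -/
theorem adjoinRoot_of_injective_of_monic {g : R[X]} (hg : g.Monic) (hdeg : 0 < g.natDegree) :
    Function.Injective (AdjoinRoot.of g) := by
  rw [injective_iff_map_eq_zero]
  intro r hr
  rw [← AdjoinRoot.mk_C, AdjoinRoot.mk_eq_zero] at hr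
  by_contra h0
  have hC : (C r) ≠ 0 := by rwa [Ne, C_eq_zero]
  exact hg.not_dvd_of_natDegree_lt hC (by rwa [natDegree_C]) hr

variable [Module.Free R M] [Module.Finite R M]

/-- `det(φ − c) = (−1)^{rank M} · χ_φ(c)`: the characteristic polynomial evaluated at a scalar is
`det(c − φ)` (Mathlib `LinearMap.eval_charpoly`). [folklore] -/
theorem det_sub_algebraMap_eq (φ : Module.End R M) (c : R) :
    LinearMap.det (φ - algebraMap R (Module.End R M) c) =
      (-1) ^ Module.finrank R M * φ.charpoly.eval c := by
  rw [LinearMap.eval_charpoly, show φ - algebraMap R (Module.End R M) c =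
      (-1 : R) • (algebraMap R (Module.End R M) c - φ) by rw [neg_one_smul, neg_sub],
    LinearMap.det_smul]

/-- **`det(φ² − aφ + q) = q^f + 1 − D_f(a; q)`** for an endomorphism `φ` of a finite free module
with characteristic polynomial `X^f − 1` (`D_f = Polynomial.dickson 1 q f`, `D_f(λ+μ; λμ) =
λ^f + μ^f`): the resultant of `X^f − 1` and `X² − aX + q`, `∏_{ζ^f=1}(ζ² − aζ + q) =
(λ^f − 1)(μ^f − 1)`.  Proof by adjoining a root of `X² − aX + q` and base change (module
docstring). [folklore] -/
theorem det_aeval_eulerPoly_of_charpoly_eq (φ : Module.End R M) (a q : R) {f : ℕ}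
    (hχ : φ.charpoly = X ^ f - 1) :
    LinearMap.det (aeval φ (X ^ 2 - C a * X + C q)) = q ^ f + 1 - (Polynomial.dickson 1 q f).eval a := by
  nontriviality R
  -- the rank is `f`
  have hrank : Module.finrank R M = f := by
    have h := φ.charpoly_natDegree
    rw [hχ, ← C_1, natDegree_X_pow_sub_C] at h
    exact h.symm
  -- `g = X² − aX + q` is monic of degree `2`
  have e : (X ^ 2 - C a * X + C q : R[X]) = X ^ 2 - (C a * X - C q) := by ring
  have hlt : (C a * X - C q : R[X]).natDegree < 2 := by
    refine (natDegree_sub_le _ _).trans_lt (max_lt ?_ ?_)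
    · exact ((natDegree_C_mul_le a X).trans natDegree_X_le).trans_lt one_lt_two
    · rw [natDegree_C]; exact two_pos
  have hgm : (X ^ 2 - C a * X + C q : R[X]).Monic := by
    rw [e]
    exact (monic_X_pow 2).sub_of_left (by
      refine (degree_le_natDegree).trans_lt ?_
      rw [degree_X_pow]
      exact_mod_cast hlt)
  have hgdeg : (X ^ 2 - C a * X + C q : R[X]).natDegree = 2 := by
    rw [e, natDegree_sub_eq_left_of_natDegree_lt] <;> rw [natDegree_X_pow]
    exact hlt
  -- adjoin a root `λ` of `g`; `μ = a − λ`
  let A := AdjoinRoot (X ^ 2 - C a * X + C q : R[X])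
  have hinj : Function.Injective (algebraMap R A) := by
    rw [AdjoinRoot.algebraMap_eq]
    exact adjoinRoot_of_injective_of_monic hgm (by rw [hgdeg]; exact two_pos)
  haveI : Nontrivial A := hinj.nontrivial
  set lam : A := AdjoinRoot.root (X ^ 2 - C a * X + C q : R[X]) with hlam
  set mu : A := algebraMap R A a - lam with hmu
  have hsum : lam + mu = algebraMap R A a := by rw [hmu]; ring
  have hlam_root : lam * lam - algebraMap R A a * lam + algebraMap R A q = 0 := by
    have h := AdjoinRoot.eval₂_root (X ^ 2 - C a * X + C q : R[X])
    simp only [eval₂_add, eval₂_sub, eval₂_mul, eval₂_C, eval₂_X, pow_two] at h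
    rw [AdjoinRoot.algebraMap_eq]
    exact h
  have hprod : lam * mu = algebraMap R A q := by
    rw [hmu]
    have : lam * (algebraMap R A a - lam) = -(lam * lam - algebraMap R A a * lam + algebraMap R A q)
        + algebraMap R A q := by ring
    rw [this, hlam_root, neg_zero, zero_add]
  -- the factorisation `g = (X − λ)(X − μ)` over `A`
  have hfac : (X ^ 2 - C a * X + C q : R[X]).map (algebraMap R A) = (X - C lam) * (X - C mu) := by
    rw [Polynomial.map_add, Polynomial.map_sub, Polynomial.map_mul, Polynomial.map_pow,
      map_X, map_C, map_C]
    have e' : (X - C lam) * (X - C mu) = X ^ 2 - C (lam + mu) * X + C (lam * mu) := by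
      simp only [map_add, map_mul]; ring
    rw [e', hsum, hprod]
  -- base change
  set φA : Module.End A (TensorProduct R A M) := φ.baseChange A with hφA
  have hχA : φA.charpoly = X ^ f - 1 := by
    rw [hφA, LinearMap.charpoly_baseChange, hχ, Polynomial.map_sub, Polynomial.map_pow, map_X,
      Polynomial.map_one]
  have hrankA : Module.finrank A (TensorProduct R A M) = f := by
    rw [Module.finrank_baseChange, hrank]
  -- `det(φ_A − c) = (−1)^f (c^f − 1)`
  have hdetc : ∀ c : A, LinearMap.det (φA - algebraMap A (Module.End A (TensorProduct R A M)) c) =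
      (-1) ^ f * (c ^ f - 1) := by
    intro c
    rw [det_sub_algebraMap_eq, hrankA, hχA, eval_sub, eval_pow, eval_X, eval_one]
  -- the base change of the Euler operator is `(φ_A − λ)(φ_A − μ)`
  have hbc : (aeval φ (X ^ 2 - C a * X + C q : R[X])).baseChange A =
      aeval φA ((X ^ 2 - C a * X + C q : R[X]).map (algebraMap R A)) := by
    rw [aeval_eulerPoly_eq, Polynomial.map_add, Polynomial.map_sub, Polynomial.map_mul,
      Polynomial.map_pow, map_X, map_C, map_C, aeval_eulerPoly_eq, hφA,
      LinearMap.baseChange_add, LinearMap.baseChange_sub, LinearMap.baseChange_mul,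
      LinearMap.baseChange_smul]
    congr 1
    · congr 1
      rw [Algebra.smul_def, Algebra.smul_def,
        IsScalarTower.algebraMap_apply R A (Module.End A (TensorProduct R A M))]
    · rw [Algebra.algebraMap_eq_smul_one, Algebra.algebraMap_eq_smul_one, LinearMap.baseChange_smul,
        LinearMap.baseChange_one, IsScalarTower.algebraMap_smul]
  have hprodA : aeval φA ((X ^ 2 - C a * X + C q : R[X]).map (algebraMap R A)) =
      (φA - algebraMap A _ lam) * (φA - algebraMap A _ mu) := by
    rw [hfac, map_mul, map_sub, map_sub, aeval_X, aeval_C, aeval_C]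
  -- assemble over `A` and descend
  have hD : algebraMap R A ((Polynomial.dickson 1 q f).eval a) = lam ^ f + mu ^ f := by
    rw [WeierstrassCurve.pow_add_pow_eq_eval_dickson hsum hprod f, ← Polynomial.eval₂_at_apply, ← eval_map,
      Polynomial.map_dickson]
  have h1 : ((-1 : A) ^ f) * ((-1 : A) ^ f) = 1 := by
    rw [← pow_add, ← two_mul, pow_mul, neg_one_sq, one_pow]
  apply hinj
  rw [← LinearMap.det_baseChange, hbc, hprodA, map_mul, hdetc, hdetc, map_sub, map_add, map_pow,
    map_one, hD, ← hprod]
  calc (-1 : A) ^ f * (lam ^ f - 1) * ((-1) ^ f * (mu ^ f - 1))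
      = ((-1 : A) ^ f * (-1) ^ f) * ((lam ^ f - 1) * (mu ^ f - 1)) := by ring
    _ = (lam * mu) ^ f + 1 - (lam ^ f + mu ^ f) := by rw [h1, mul_pow]; ring

/-! ## When is the characteristic polynomial `X^f − 1`? -/

/-- **`χ_φ = X^f − 1` for an endomorphism with `φ^f = 1`, `f = rank M > 0`, whose first `f` powers
are linearly independent** (e.g. a generator of a cyclic group of order `f` in its regular
representation; the Frobenius of an unramified extension of degree `f` on its valuation ring, by
Dedekind's independence of characters).  Cayley–Hamilton: `χ_φ(φ) = 0 = φ^f − 1`, so the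
difference `χ_φ − (X^f − 1)`, of degree `< f`, is a linear relation among `1, φ, …, φ^{f−1}`.
[folklore] -/
theorem charpoly_eq_X_pow_sub_one_of_linearIndependent (φ : Module.End R M) {f : ℕ} (hf0 : 0 < f)
    (hf : Module.finrank R M = f) (hpow : φ ^ f = 1)
    (hli : LinearIndependent R fun i : Fin f => φ ^ (i : ℕ)) : φ.charpoly = X ^ f - 1 := by
  nontriviality R
  set r : R[X] := φ.charpoly - (X ^ f - 1) with hr
  -- `deg r < f`
  have hmon : (X ^ f - 1 : R[X]).Monic := by
    rw [← C_1]; exact monic_X_pow_sub_C (1 : R) hf0.ne'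
  have hdeg : r.natDegree < f := by
    rw [hr]
    by_cases h0 : φ.charpoly - (X ^ f - 1) = 0
    · rw [h0, natDegree_zero]; exact hf0
    have hcm : φ.charpoly.Monic := LinearMap.charpoly_monic φ
    refine lt_of_lt_of_le (natDegree_lt_natDegree h0
      (degree_sub_lt ?_ (Polynomial.Monic.ne_zero hcm) ?_)) ?_
    · rw [degree_eq_natDegree (Polynomial.Monic.ne_zero hcm),
        degree_eq_natDegree (Polynomial.Monic.ne_zero hmon),
        φ.charpoly_natDegree, hf, ← C_1, natDegree_X_pow_sub_C]
    · rw [Polynomial.Monic.leadingCoeff hcm, Polynomial.Monic.leadingCoeff hmon]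
    · rw [φ.charpoly_natDegree, hf]
  -- `r(φ) = 0`
  have haeval : aeval φ r = 0 := by
    rw [hr, map_sub, LinearMap.aeval_self_charpoly, map_sub, map_pow, aeval_X, aeval_one, hpow,
      sub_self, sub_zero]
  -- hence all coefficients vanish
  have hsum : ∑ i : Fin f, r.coeff i • φ ^ (i : ℕ) = 0 := by
    rw [← haeval, aeval_eq_sum_range' hdeg, Finset.sum_range]
  have hcoeff : ∀ i : Fin f, r.coeff i = 0 := fun i ↦
    (Fintype.linearIndependent_iff.mp hli (fun i ↦ r.coeff i) hsum) i
  have hr0 : r = 0 := by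
    ext i
    rw [coeff_zero]
    by_cases hi : i < f
    · exact hcoeff ⟨i, hi⟩
    · exact coeff_eq_zero_of_natDegree_lt (lt_of_lt_of_le hdeg (not_lt.mp hi))
  exact sub_eq_zero.mp hr0

/-- Over a domain, an endomorphism of a finite free module with non-zero determinant is injective
(a kernel vector would be a non-trivial solution of `A v = 0`, Mathlib
`Matrix.exists_mulVec_eq_zero_iff`). [folklore] -/
theorem injective_of_det_ne_zero [IsDomain R] (T : Module.End R M) (hT : LinearMap.det T ≠ 0) :
    Function.Injective T := by
  classical
  let b := Module.Free.chooseBasis R M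
  rw [← LinearMap.ker_eq_bot, Submodule.eq_bot_iff]
  intro v hv
  rw [LinearMap.mem_ker] at hv
  by_contra hv0
  apply hT
  rw [← LinearMap.det_toMatrix b]
  refine Matrix.exists_mulVec_eq_zero_iff.mp ⟨b.repr v, ?_, ?_⟩
  · intro h
    have h' : b.repr v = 0 := Finsupp.ext fun i => by simpa using congrFun h i
    exact hv0 ((LinearEquiv.map_eq_zero_iff b.repr).mp h')
  · have h := LinearMap.toMatrix_mulVec_repr b b T v
    rw [hv, map_zero] at h
    rw [h]
    rfl

end CommRing

/-! ## The index over `ℤ_p` -/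

section Padic

variable {p : ℕ} [Fact p.Prime] {M : Type*} [AddCommGroup M] [Module ℤ_[p] M]
  [Module.Free ℤ_[p] M] [Module.Finite ℤ_[p] M]

/-- **`#(M ⧸ (φ² − aφ + q)M) = p ^ v_p(q^f + 1 − D_f(a; q))`** for an endomorphism `φ` of a finite
free `ℤ_p`-module with characteristic polynomial `X^f − 1`, whenever `q^f + 1 − D_f(a; q) ≠ 0`
(`det_aeval_eulerPoly_of_charpoly_eq` with the tree's `natCard_quotient_range_eq_pow_valuation_det`).
For `φ` the Frobenius of an unramified `K/ℚ_p` of degree `f` on `M = 𝒪_K`, `a = a_p`, `q = p`: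
the index of the Euler lattice `(φ² − a_pφ + p)𝒪_K` in `𝒪_K` is the `p`-part of
`p^f + 1 − (α^f + β^f) = #Ẽ(𝔽_{p^f})`. [cite: StacksProject, Tag 02QG] -/
theorem natCard_quotient_range_aeval_eulerPoly_of_charpoly_eq (φ : Module.End ℤ_[p] M) (a q : ℤ_[p])
    {f : ℕ} (hχ : φ.charpoly = X ^ f - 1) (hN : q ^ f + 1 - (Polynomial.dickson 1 q f).eval a ≠ 0) :
    Nat.card (M ⧸ LinearMap.range (aeval φ (X ^ 2 - C a * X + C q))) =
      p ^ (q ^ f + 1 - (Polynomial.dickson 1 q f).eval a).valuation := by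
  have hdet := det_aeval_eulerPoly_of_charpoly_eq φ a q hχ
  rw [← hdet]
  refine natCard_quotient_range_eq_pow_valuation_det (Module.Free.chooseBasis ℤ_[p] M) _ ?_
  exact injective_of_det_ne_zero _ (by rw [hdet]; exact hN)

end Padic






end Summit.BirchSwinnertonDyer.BirchSwinnertonDyer.Theorems.KimAtThreeEulerOperatorDeterminant
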